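import Literature.Probability.RandomPlanarGeometry.HexSAWSurfaceWallRenewalCensusEngine
import Literature.Probability.RandomPlanarGeometry.HexSAWSurfaceWallRenewalSixStepRigid
import Literature.Probability.RandomPlanarGeometry.HexSAWSurfaceWallRenewalIteratedGap
import HarnessLib

/-!
# «CENSUS-ENGINE-FAST»: the wall-renewal counting engine with scalar state, look-ahead pruning and count-only output, proved exact

Topic `Literature/Probability/RandomPlanarGeometry` (lane «pcv-sawmu», a-p6 g22; parents: this lineage's «CENSUS-ENGINE» (p519620,
`HexSAWSurfaceWallRenewalCensusEngine`: the state-carrying list search `WCount.grow` with SOUNDNESS and COMPLETENESS, ★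
`WCount.card_filter_visits_ipwb_eq_census`), the six-step law and its rigidity (`HexSAWSurfaceWallRenewalSixStep(Rigid)`: `2v + 2 ≤ X_n`,
`X_n + 4v ≤ n + 2`, `X_n + #down + 4v ≤ n + 4`, `#down + 6v ≤ n + 2`) and a-idea-1's iterated gap (`HexSAWSurfaceWallRenewalIteratedGap`, #813:
`2·#down + 6v ≤ n + 4`)).

WHY.  The class numbers `N_{s,v} = #{ω ∈ ipwb (2s) | visits = v}` of the wall-renewal census of the adsorbing honeycomb walk enter Kesten's identity
diagonal by diagonal (`s − v = d` gives the coefficient `a_{d−1}` of `β(y)² = y + Σ a_k y^{−k}`); through order eleven (`a₁₀ = −16`) they were certified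
by «CENSUS-ENGINE» at ≈ 1.5 ms per search node in the kernel, and the ORDER-TWELVE diagonal `(13,1) … (17,5)` costs that engine 10.2 million nodes
(≈ 4 h of gate time).  This module is the same search made cheap enough: (i) the state is eight SCALARS `(x, d, mask, n, v, mx, pm, nd)` — the pending
RECORD-VISIT LIST of the engine is replaced by its least element `pm` (`0` = none; it is all the final test and the cuts need, and it is tracked exactly:
`pmOf_pendNext`), plus a down-step counter `nd`; (ii) the output is a COUNT (`cnt`, curried, every operation a kernel-accelerated `Nat` primitive:
≈ 0.5 ms per node); (iii) six LOOK-AHEAD CUTS prune every prefix that provably has no completion — bridge `max(mx,x') − x' + d' ≤ r`, end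
`2V + 2 − x' + d' ≤ r`, irreducibility `(x' − p) + (max(mx,x') − p) + d' ≤ r` (the walk must still dive to the column of its least pending record `p`,
below the wall, and come back beyond its running maximum), and the budgets `max(mx,x') + 4V ≤ N + 2`, `nd' + 6V ≤ N + 2`, `2nd' + 6V ≤ N + 4`,
`max(mx,x') + nd' + 4V ≤ N + 4`.  Order twelve then costs ≈ 1.47 million nodes (replica: `100 639 / 261 405 / 420 555 / 495 911 / 190 611` for
`(26,1) … (34,5)`), and the thirteen already-certified classes of orders seven to eleven are reproduced by the replica with the cuts on.

## What is proved (namespace `…SAW.HexBW.Wall.WFast`; `N`, `V` symbolic)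
* §1 the scalar search `vNext`, `mxNext`, `pmNext`, ★ `okF` (test + cuts), ★ `cnt`, `fcount N V`; kernel sanity `fcount 16 1 = 38`, `fcount 20 3 = 7`;
  §1b `okF_iff` (the test as eleven propositions).
* §2 the list twin `growT` / `censusT` of the pruned search and ★ `length_growT_eq_cnt`, `length_censusT : #censusT = fcount`;
  §3 its unfolding lemmas and ★ `nodup_growT`.
* §4 ★★ `mem_grow_of_mem_growT`: the pruned search is a SUB-SEARCH of the engine's, state by state, through the abstraction `pmOf` (head of the
  engine's pending list, whose shape `PendOK` — nondecreasing, positive — is an invariant: `pendOK_next`, ★ `pmOf_pendNext`); hence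
  `mem_census_of_mem_censusT` (soundness and injectivity are inherited from the engine).
* §5 ★★ COMPLETENESS `revList_mem_censusT`: a genuine `ω ∈ ipwb N` (`N ≥ 4`) passes every cut at every step (`okF_traj`): the engine's five
  conditions by `WCount.ok_traj`; the bridge / end cuts by the Manhattan bound `abs_add_abs_le` to the final site `(X_N, 0)` with `X_N ≥ mx`,
  `X_N ≥ 2v + 2`; the irreducibility cut because the least pending record `X_k` is not a wall-renewal time, so a LATER abscissa is `≤ X_k`
  (three-point bound `abs_three_le`); the budgets by the six-step theorems quoted above with `#down` monotone in time (`card_stepsD_mono`).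
* §6 ★★★ `card_filter_visits_ipwb_eq_fcount (hN : N % 2 = 0) (h4 : 4 ≤ N) : #{ω ∈ ipwb N | visits N ω = V} = fcount N V` and
  `fcount_eq_length_census` (agreement with the engine's census).
* §7 the split API for piecewise kernel evaluation: `cntS`, `kidsF`, `cntS_succ`, `expandF`, `sum_cntS_eq_expand`, ★ `fcount_eq_sum_range`
  (`fcount N V = Σ_{i<n} cntS (N − k) (prefix state i)`, each summand its own `decide +kernel`), kernel sanity `fcount_twenty_three_split`.
NOT claimed here: any new census (the order-twelve classes are separate cars on this engine).  No budget line (`set_option`) is used.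
Label (lane): LANE TOOLING / ENGINE (M), own; NEW IN WRITING only as a verified program.  Sources (for the objects; the engine is ours):
[MadrasSlade1993, Section 1.2, Definition 1.2.4; Section 4.2, Definition 4.2.1, (4.2.2), remark before (4.2.21) (p. 94)] (bridges, irreducible bridges,
renewal times, the `3L`-steps remark), [Kesten1963SAW, Section 4] (irreducible bridges), [EntingJensen2009, Section 7.4.2, Fig. 7.10] (brickwork form of the
honeycomb lattice; finite-lattice enumeration with pruning), [BeatonBousquetMelouDeGierDuminilCopinGuttmann2014, Section 3.1 (arXiv v5 p. 8)] (surface visits).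
-/

namespace Literature.Probability.RandomPlanarGeometry.SAW.HexBW.Wall

open Finset Function Census
open Literature.Probability.LatticeModels
open Literature.Probability.FitznerVanDerHofstad2017 (natBeq_eq_decide natBle_eq_decide)

namespace WFast

/-! ### §1  The scalar search: state `(x, d, mask, n, v, mx, pm, nd)`, look-ahead test, count -/

/-- Visit counter after a move to depth `d'` at time `n + 1`. [cite: MadrasSlade1993, Section 4.2, Definition 4.2.1] -/
def vNext (n d' v : ℕ) : ℕ := bif Nat.beq (Nat.mod (Nat.add n 1) 2) 0 && Nat.beq d' 0 then Nat.add v 1 else v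

/-- Running maximum after a move to abscissa `x'`. [cite: MadrasSlade1993, Section 4.2, Definition 4.2.1] -/
def mxNext (mx x' : ℕ) : ℕ := bif Nat.ble mx x' then x' else mx

/-- The LEAST pending record abscissa after a move to `(x', −d')` at time `n + 1` with `r` steps to go (`0` = nothing pending): records `≥ x'` are
discharged — so the least one survives unless `x' ≤` it — and an interior record visit is registered when nothing is pending.
[cite: MadrasSlade1993, Section 4.2, Definition 4.2.1] -/
def pmNext (r x' d' n mx pm : ℕ) : ℕ :=
  bif Nat.ble x' pm || Nat.beq pm 0 then
    (bif Nat.beq (Nat.mod (Nat.add n 1) 2) 0 && Nat.beq d' 0 && Nat.ble mx x' && !(Nat.beq r 0) then x' else 0)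
  else pm

/-- **The pruning test** of a move to `(x', −d')` (`dn = 1` for a down step) with `r` steps to go after it, on the scalar state: the engine's five
conditions (fresh site, parity feasibility of the remaining visits, visit budget, depth, positivity) interleaved with six LOOK-AHEAD CUTS that every
irreducible positive wall bridge passes — bridge `max(mx,x') − x' + d' ≤ r`, end `2V + 2 − x' + d' ≤ r`, irreducibility `(x' − p) + (max(mx,x') − p) + d' ≤ r`
for the least pending record `p`, and the six-step-law budgets `max(mx,x') + nd' + 4V ≤ N + 4`, `nd' + 6V ≤ N + 2`, `max(mx,x') + 4V ≤ N + 2`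
(ordered cheapest-and-most-selective first; all arithmetic on kernel-accelerated `Nat` operations).
[cite: MadrasSlade1993, Section 1.2, Definition 1.2.4; Section 4.2, Definition 4.2.1] -/
def okF (V B N r x' d' dn mask n v mx pm nd : ℕ) : Bool :=
  let v' := vNext n d' v
  let mx' := mxNext mx x'
  let p := pmNext r x' d' n mx pm
  let nd' := Nat.add nd dn
  Nat.beq (Nat.mod (Nat.shiftRight mask (Nat.add (Nat.mul x' B) d')) 2) 0 &&
  Nat.ble (Nat.sub V v') (Nat.sub (Nat.div (Nat.add (Nat.add n 1) r) 2) (Nat.div (Nat.add n (bif Nat.beq d' 0 then 1 else d')) 2)) &&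
  Nat.ble (Nat.add (Nat.sub mx' x') d') r &&
  Nat.ble (Nat.add (Nat.sub (Nat.add (Nat.mul 2 V) 2) x') d') r &&
  (Nat.beq p 0 || Nat.ble (Nat.add (Nat.add (Nat.sub x' p) (Nat.sub mx' p)) d') r) &&
  Nat.ble (Nat.add (Nat.add mx' nd') (Nat.mul 4 V)) (Nat.add N 4) &&
  Nat.ble (Nat.add nd' (Nat.mul 6 V)) (Nat.add N 2) &&
  Nat.ble (Nat.add (Nat.mul 2 nd') (Nat.mul 6 V)) (Nat.add N 4) &&
  Nat.ble (Nat.add mx' (Nat.mul 4 V)) (Nat.add N 2) &&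
  Nat.ble (Nat.add v' (bif Nat.beq r 0 then 0 else 1)) V &&
  Nat.ble d' r && Nat.ble 1 x'

/-- **The scalar count** `cnt V B N r x d mask n v mx pm nd`: the number of admissible completions with `r` steps to go (children right, left, vertical).
[cite: MadrasSlade1993, Section 4.2, Definition 4.2.1] -/
def cnt (V B N : ℕ) : ℕ → ℕ → ℕ → ℕ → ℕ → ℕ → ℕ → ℕ → ℕ → ℕ
  | 0, x, _, _, _, v, mx, pm, _ => bif Nat.beq v V && Nat.beq mx x && Nat.beq pm 0 then 1 else 0
  | r + 1, x, d, mask, n, v, mx, pm, nd =>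
    Nat.add (Nat.add
      (bif okF V B N r (x + 1) d 0 mask n v mx pm nd then
        cnt V B N r (x + 1) d (Nat.lor mask (Nat.pow 2 (Nat.add (Nat.mul (x + 1) B) d))) (n + 1) (vNext n d v) (mxNext mx (x + 1)) (pmNext r (x + 1) d n mx pm) (Nat.add nd 0)
       else 0)
      (bif okF V B N r (x - 1) d 0 mask n v mx pm nd then
        cnt V B N r (x - 1) d (Nat.lor mask (Nat.pow 2 (Nat.add (Nat.mul (x - 1) B) d))) (n + 1) (vNext n d v) (mxNext mx (x - 1)) (pmNext r (x - 1) d n mx pm) (Nat.add nd 0)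
       else 0))
      (bif Nat.beq ((x + d) % 2) 0 then
        (bif Nat.ble 1 d then
          (bif okF V B N r x (d - 1) 0 mask n v mx pm nd then
            cnt V B N r x (d - 1) (Nat.lor mask (Nat.pow 2 (Nat.add (Nat.mul x B) (d - 1)))) (n + 1) (vNext n (d - 1) v) (mxNext mx x) (pmNext r x (d - 1) n mx pm) (Nat.add nd 0)
           else 0)
         else 0)
       else
        (bif okF V B N r x (d + 1) 1 mask n v mx pm nd then
          cnt V B N r x (d + 1) (Nat.lor mask (Nat.pow 2 (Nat.add (Nat.mul x B) (d + 1)))) (n + 1) (vNext n (d + 1) v) (mxNext mx x) (pmNext r x (d + 1) n mx pm) (Nat.add nd 1)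
         else 0))

/-- **The fast census count** of the class `(N, V)` (from the origin: mask bit `0` set, nothing visited, pending or counted).
[cite: MadrasSlade1993, Section 4.2, Definition 4.2.1, (4.2.2)] -/
def fcount (N V : ℕ) : ℕ := cnt V (N + 1) N N 0 0 1 0 0 0 0 0

/-- Sanity: the fast count of the class `(8,1)` is `38` (car 72 / engine `N₈,₁ = 38`). [cite: MadrasSlade1993, Section 4.2, (4.2.2)] -/
theorem fcount_sixteen_one : fcount 16 1 = 38 := by decide +kernel

/-- Sanity: `(10,3)` ↦ `7` (`N₁₀,₃ = 7`). [cite: MadrasSlade1993, Section 4.2, (4.2.2)] -/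
theorem fcount_twenty_three : fcount 20 3 = 7 := by decide +kernel

/-! ### §1b  Reading the scalar test -/

/-- [folklore] The kernel spelling of `%` (private twin of the tree's `rfl` lemmas). -/
private theorem natMod_eq (a b : ℕ) : Nat.mod a b = a % b := rfl

/-- [folklore] The kernel spelling of `/` (private twin of the tree's `rfl` lemmas). -/
private theorem natDiv_eq (a b : ℕ) : Nat.div a b = a / b := rfl

/-- `vNext` in `if` form. [cite: MadrasSlade1993, Section 4.2, Definition 4.2.1] -/
theorem vNext_eq (n d' v : ℕ) : vNext n d' v = v + (if (n + 1) % 2 = 0 ∧ d' = 0 then 1 else 0) := by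
  simp only [vNext, natBeq_eq_decide, natMod_eq, Nat.add_eq]
  by_cases h1 : (n + 1) % 2 = 0 <;> by_cases h2 : d' = 0 <;> simp [h1, h2]

/-- `mxNext` is the maximum. [cite: MadrasSlade1993, Section 4.2, Definition 4.2.1] -/
theorem mxNext_eq (mx x' : ℕ) : mxNext mx x' = max mx x' := by
  simp only [mxNext, natBle_eq_decide]
  by_cases h : mx ≤ x'
  · simp [h]
  · simp [h, max_eq_left (le_of_not_ge h)]

/-- `pmNext` in `if` form. [cite: MadrasSlade1993, Section 4.2, Definition 4.2.1] -/
theorem pmNext_eq (r x' d' n mx pm : ℕ) : pmNext r x' d' n mx pm =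
    if x' ≤ pm ∨ pm = 0 then (if (n + 1) % 2 = 0 ∧ d' = 0 ∧ mx ≤ x' ∧ r ≠ 0 then x' else 0) else pm := by
  simp only [pmNext, natBeq_eq_decide, natBle_eq_decide, natMod_eq, Nat.add_eq]
  by_cases h0 : x' ≤ pm <;> by_cases h0' : pm = 0 <;> by_cases h1 : (n + 1) % 2 = 0 <;> by_cases h2 : d' = 0 <;>
    by_cases h3 : mx ≤ x' <;> by_cases h4 : r = 0 <;> simp [h0, h0', h1, h2, h3, h4]

/-- The kernel spelling of the fresh-site test reads the visited bitmask. [cite: EntingJensen2009, Section 7.4.2, Fig. 7.10] -/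
theorem mod_shiftRight_iff (mask k : ℕ) : Nat.mod (Nat.shiftRight mask k) 2 = 0 ↔ Nat.testBit mask k = false := by
  rw [Nat.testBit_eq_decide_div_mod_eq, show Nat.shiftRight mask k = mask >>> k from rfl, Nat.shiftRight_eq_div_pow,
    show Nat.mod (mask / 2 ^ k) 2 = mask / 2 ^ k % 2 from rfl]
  constructor
  · intro h; rw [h]; decide
  · intro h
    have := of_decide_eq_false h
    omega

/-- The kernel spelling of `max d' 1`. [cite: MadrasSlade1993, Section 4.2, Definition 4.2.1] -/
theorem cond_beq_zero_eq_max (d' : ℕ) : (bif Nat.beq d' 0 then 1 else d') = max d' 1 := by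
  rcases Nat.eq_zero_or_pos d' with rfl | h
  · rfl
  · rw [show Nat.beq d' 0 = false from (natBeq_eq_decide _ _).trans (decide_eq_false (by omega)), cond_false, max_eq_left h]

/-- ★ **Unfolding the scalar test**: the engine's five conditions and the six look-ahead cuts, as propositions.
[cite: MadrasSlade1993, Section 1.2, Definition 1.2.4; Section 4.2, Definition 4.2.1] -/
theorem okF_iff {V B N r x' d' dn mask n v mx pm nd : ℕ} :
    okF V B N r x' d' dn mask n v mx pm nd = true ↔
      Nat.testBit mask (WCount.key B x' d') = false ∧
      V - vNext n d' v ≤ (n + 1 + r) / 2 - (n + max d' 1) / 2 ∧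
      mxNext mx x' - x' + d' ≤ r ∧
      2 * V + 2 - x' + d' ≤ r ∧
      (pmNext r x' d' n mx pm = 0 ∨ (x' - pmNext r x' d' n mx pm) + (mxNext mx x' - pmNext r x' d' n mx pm) + d' ≤ r) ∧
      mxNext mx x' + (nd + dn) + 4 * V ≤ N + 4 ∧
      (nd + dn) + 6 * V ≤ N + 2 ∧
      2 * (nd + dn) + 6 * V ≤ N + 4 ∧
      mxNext mx x' + 4 * V ≤ N + 2 ∧
      vNext n d' v + (if r = 0 then 0 else 1) ≤ V ∧
      d' ≤ r ∧ 1 ≤ x' := by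
  have e2 : (bif Nat.beq r 0 then 0 else 1) = (if r = 0 then 0 else 1 : ℕ) := by
    simp only [natBeq_eq_decide]
    by_cases h : r = 0 <;> simp [h]
  simp only [okF, Bool.and_eq_true, Bool.or_eq_true, Nat.ble_eq, Nat.add_eq, Nat.sub_eq, Nat.mul_eq, natDiv_eq,
    cond_beq_zero_eq_max, e2, Nat.beq_eq, mod_shiftRight_iff, WCount.key]
  tauto

/-! ### §2  The same pruned search with LIST output (the bridge to the engine's soundness and completeness theorems) -/

/-- Tuple form of the scalar state. [cite: MadrasSlade1993, Section 4.2, Definition 4.2.1] -/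
abbrev St : Type := ℕ × ℕ × ℕ × ℕ × ℕ × ℕ × ℕ × ℕ

/-- The pruning test on a tuple state. [cite: MadrasSlade1993, Section 4.2, Definition 4.2.1] -/
def okT (V B N r x' d' dn : ℕ) (s : St) : Bool :=
  match s with
  | (_, _, mask, n, v, mx, pm, nd) => okF V B N r x' d' dn mask n v mx pm nd

/-- The tuple state after a move. [cite: MadrasSlade1993, Section 4.2, Definition 4.2.1] -/
def advT (B r x' d' dn : ℕ) (s : St) : St :=
  match s with
  | (_, _, mask, n, v, mx, pm, nd) =>
    (x', d', Nat.lor mask (Nat.pow 2 (Nat.add (Nat.mul x' B) d')), n + 1, vNext n d' v, mxNext mx x', pmNext r x' d' n mx pm, Nat.add nd dn)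

/-- One child of the list search: the completions through the move to `(x', −d')`, if admissible. [cite: MadrasSlade1993, Section 4.2, Definition 4.2.1] -/
def childT (V B N r x' d' dn : ℕ) (s : St) (l : List (ℤ × ℤ)) (k : St → List (ℤ × ℤ) → List (List (ℤ × ℤ))) :
    List (List (ℤ × ℤ)) :=
  bif okT V B N r x' d' dn s then k (advT B r x' d' dn s) (WCount.site x' d' :: l) else []

/-- **The pruned search with list output** (reversed integer site lists), same moves and tests as `cnt`. [cite: MadrasSlade1993, Section 4.2, Definition 4.2.1] -/
def growT (V B N : ℕ) : ℕ → St → List (ℤ × ℤ) → List (List (ℤ × ℤ))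
  | 0, s, l => (match s with
    | (x, _, _, _, v, mx, pm, _) => bif Nat.beq v V && Nat.beq mx x && Nat.beq pm 0 then [l] else [])
  | r + 1, s, l =>
    match s with
    | (x, d, _, _, _, _, _, _) =>
      childT V B N r (x + 1) d 0 s l (fun s' l' => growT V B N r s' l') ++
      childT V B N r (x - 1) d 0 s l (fun s' l' => growT V B N r s' l') ++
      (bif Nat.beq ((x + d) % 2) 0 then
        (bif Nat.ble 1 d then childT V B N r x (d - 1) 0 s l (fun s' l' => growT V B N r s' l') else [])
       else childT V B N r x (d + 1) 1 s l (fun s' l' => growT V B N r s' l'))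

/-- The list census of the class `(N, V)` by the pruned search. [cite: MadrasSlade1993, Section 4.2, Definition 4.2.1, (4.2.2)] -/
def censusT (N V : ℕ) : List (List (ℤ × ℤ)) := growT V (N + 1) N N (0, 0, 1, 0, 0, 0, 0, 0) [(0, 0)]

variable {V B N : ℕ}

/-- Length of a child, given the count one level down. [cite: MadrasSlade1993, Section 4.2, Definition 4.2.1] -/
theorem length_childT {r x' d' dn x d mask n v mx pm nd : ℕ} {l : List (ℤ × ℤ)}
    (ih : ∀ (x d mask n v mx pm nd : ℕ) (l : List (ℤ × ℤ)),
      (growT V B N r (x, d, mask, n, v, mx, pm, nd) l).length = cnt V B N r x d mask n v mx pm nd) :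
    (childT V B N r x' d' dn (x, d, mask, n, v, mx, pm, nd) l fun s' l' => growT V B N r s' l').length =
      (bif okF V B N r x' d' dn mask n v mx pm nd then
        cnt V B N r x' d' (Nat.lor mask (Nat.pow 2 (Nat.add (Nat.mul x' B) d'))) (n + 1) (vNext n d' v) (mxNext mx x')
          (pmNext r x' d' n mx pm) (Nat.add nd dn) else 0) := by
  have e1 : okT V B N r x' d' dn (x, d, mask, n, v, mx, pm, nd) = okF V B N r x' d' dn mask n v mx pm nd := rfl
  have e2 : advT B r x' d' dn (x, d, mask, n, v, mx, pm, nd) =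
      (x', d', Nat.lor mask (Nat.pow 2 (Nat.add (Nat.mul x' B) d')), n + 1, vNext n d' v, mxNext mx x', pmNext r x' d' n mx pm,
        Nat.add nd dn) := rfl
  rw [childT, e1, e2]
  cases okF V B N r x' d' dn mask n v mx pm nd
  · rfl
  · exact ih _ _ _ _ _ _ _ _ _

/-- ★ **The scalar count is the length of the list search.** [cite: MadrasSlade1993, Section 4.2, Definition 4.2.1] -/
theorem length_growT_eq_cnt : ∀ (r x d mask n v mx pm nd : ℕ) (l : List (ℤ × ℤ)),
    (growT V B N r (x, d, mask, n, v, mx, pm, nd) l).length = cnt V B N r x d mask n v mx pm nd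
  | 0, x, d, mask, n, v, mx, pm, nd, l => by
    show (bif Nat.beq v V && Nat.beq mx x && Nat.beq pm 0 then [l] else []).length =
      (bif Nat.beq v V && Nat.beq mx x && Nat.beq pm 0 then 1 else 0)
    cases (Nat.beq v V && Nat.beq mx x && Nat.beq pm 0) <;> rfl
  | r + 1, x, d, mask, n, v, mx, pm, nd, l => by
    have ih : ∀ (x d mask n v mx pm nd : ℕ) (l : List (ℤ × ℤ)),
        (growT V B N r (x, d, mask, n, v, mx, pm, nd) l).length = cnt V B N r x d mask n v mx pm nd :=
      fun x d mask n v mx pm nd l => length_growT_eq_cnt r x d mask n v mx pm nd l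
    rw [growT, cnt]
    simp only [List.length_append, length_childT ih, Nat.add_eq]
    cases Nat.beq ((x + d) % 2) 0 <;> cases Nat.ble 1 d <;> simp [length_childT ih]

/-- ★ `fcount N V = (censusT N V).length`. [cite: MadrasSlade1993, Section 4.2, Definition 4.2.1, (4.2.2)] -/
theorem length_censusT (N V : ℕ) : (censusT N V).length = fcount N V :=
  length_growT_eq_cnt _ _ _ _ _ _ _ _ _ _

/-! ### §3  Unfolding the list search; it is duplicate-free -/

/-- Membership in a child. [cite: MadrasSlade1993, Section 4.2, Definition 4.2.1] -/
theorem mem_childT {r x' d' dn : ℕ} {s : St} {l y : List (ℤ × ℤ)} {k : St → List (ℤ × ℤ) → List (List (ℤ × ℤ))} :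
    y ∈ childT V B N r x' d' dn s l k ↔ okT V B N r x' d' dn s = true ∧ y ∈ k (advT B r x' d' dn s) (WCount.site x' d' :: l) := by
  unfold childT
  cases okT V B N r x' d' dn s <;> simp

/-- Membership at a leaf. [cite: MadrasSlade1993, Section 4.2, Definition 4.2.1] -/
theorem mem_growT_zero {x d mask n v mx pm nd : ℕ} {l y : List (ℤ × ℤ)} :
    y ∈ growT V B N 0 (x, d, mask, n, v, mx, pm, nd) l ↔ (Nat.beq v V && Nat.beq mx x && Nat.beq pm 0) = true ∧ y = l := by
  show y ∈ (bif Nat.beq v V && Nat.beq mx x && Nat.beq pm 0 then [l] else []) ↔ _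
  cases (Nat.beq v V && Nat.beq mx x && Nat.beq pm 0) <;> simp

/-- Membership one level down: through one of the (at most three) admissible moves. [cite: MadrasSlade1993, Section 4.2, Definition 4.2.1] -/
theorem mem_growT_succ {r x d mask n v mx pm nd : ℕ} {l y : List (ℤ × ℤ)}
    (h : y ∈ growT V B N (r + 1) (x, d, mask, n, v, mx, pm, nd) l) :
    ∃ x' d' dn, ((x' = x + 1 ∧ d' = d ∧ dn = 0) ∨ (x' = x - 1 ∧ d' = d ∧ dn = 0) ∨ (x' = x ∧ d' + 1 = d ∧ (x + d) % 2 = 0 ∧ dn = 0) ∨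
        (x' = x ∧ d' = d + 1 ∧ (x + d) % 2 = 1 ∧ dn = 1)) ∧
      okT V B N r x' d' dn (x, d, mask, n, v, mx, pm, nd) = true ∧
      y ∈ growT V B N r (advT B r x' d' dn (x, d, mask, n, v, mx, pm, nd)) (WCount.site x' d' :: l) := by
  rw [growT] at h
  simp only [List.mem_append] at h
  rcases h with (h | h) | h
  · obtain ⟨hok, hy⟩ := mem_childT.1 h
    exact ⟨x + 1, d, 0, Or.inl ⟨rfl, rfl, rfl⟩, hok, hy⟩
  · obtain ⟨hok, hy⟩ := mem_childT.1 h
    exact ⟨x - 1, d, 0, Or.inr (Or.inl ⟨rfl, rfl, rfl⟩), hok, hy⟩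
  · revert h
    cases hpar : Nat.beq ((x + d) % 2) 0 <;> intro h
    · rw [cond_false] at h
      obtain ⟨hok, hy⟩ := mem_childT.1 h
      have hp : (x + d) % 2 = 1 := by have := Nat.ne_of_beq_eq_false hpar; omega
      exact ⟨x, d + 1, 1, Or.inr (Or.inr (Or.inr ⟨rfl, rfl, hp, rfl⟩)), hok, hy⟩
    · rw [cond_true] at h
      have hp : (x + d) % 2 = 0 := Nat.eq_of_beq_eq_true hpar
      revert h
      cases hd : Nat.ble 1 d <;> intro h
      · rw [cond_false] at h; simp at h
      · rw [cond_true] at h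
        obtain ⟨hok, hy⟩ := mem_childT.1 h
        have h1 : 1 ≤ d := Nat.le_of_ble_eq_true hd
        exact ⟨x, d - 1, 0, Or.inr (Or.inr (Or.inl ⟨rfl, by omega, hp, rfl⟩)), hok, hy⟩

/-- The right move's completions are completions. [cite: MadrasSlade1993, Section 4.2, Definition 4.2.1] -/
theorem mem_growT_succ_of_right {r x d mask n v mx pm nd : ℕ} {l y : List (ℤ × ℤ)}
    (hok : okT V B N r (x + 1) d 0 (x, d, mask, n, v, mx, pm, nd) = true)
    (hy : y ∈ growT V B N r (advT B r (x + 1) d 0 (x, d, mask, n, v, mx, pm, nd)) (WCount.site (x + 1) d :: l)) :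
    y ∈ growT V B N (r + 1) (x, d, mask, n, v, mx, pm, nd) l := by
  rw [growT]
  simp only [List.mem_append]
  exact Or.inl (Or.inl (mem_childT.2 ⟨hok, hy⟩))

/-- The left move's completions are completions. [cite: MadrasSlade1993, Section 4.2, Definition 4.2.1] -/
theorem mem_growT_succ_of_left {r x d mask n v mx pm nd : ℕ} {l y : List (ℤ × ℤ)}
    (hok : okT V B N r (x - 1) d 0 (x, d, mask, n, v, mx, pm, nd) = true)
    (hy : y ∈ growT V B N r (advT B r (x - 1) d 0 (x, d, mask, n, v, mx, pm, nd)) (WCount.site (x - 1) d :: l)) :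
    y ∈ growT V B N (r + 1) (x, d, mask, n, v, mx, pm, nd) l := by
  rw [growT]
  simp only [List.mem_append]
  exact Or.inl (Or.inr (mem_childT.2 ⟨hok, hy⟩))

/-- The upward move's completions are completions. [cite: MadrasSlade1993, Section 4.2, Definition 4.2.1] -/
theorem mem_growT_succ_of_up {r x d mask n v mx pm nd : ℕ} {l y : List (ℤ × ℤ)} (hpar : (x + d) % 2 = 0) (hd : 1 ≤ d)
    (hok : okT V B N r x (d - 1) 0 (x, d, mask, n, v, mx, pm, nd) = true)
    (hy : y ∈ growT V B N r (advT B r x (d - 1) 0 (x, d, mask, n, v, mx, pm, nd)) (WCount.site x (d - 1) :: l)) :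
    y ∈ growT V B N (r + 1) (x, d, mask, n, v, mx, pm, nd) l := by
  rw [growT]
  simp only [List.mem_append]
  refine Or.inr ?_
  rw [show Nat.beq ((x + d) % 2) 0 = true from (natBeq_eq_decide _ _).trans (decide_eq_true hpar), cond_true,
    show Nat.ble 1 d = true from Nat.ble_eq_true_of_le hd, cond_true]
  exact mem_childT.2 ⟨hok, hy⟩

/-- The downward move's completions are completions. [cite: MadrasSlade1993, Section 4.2, Definition 4.2.1] -/
theorem mem_growT_succ_of_down {r x d mask n v mx pm nd : ℕ} {l y : List (ℤ × ℤ)} (hpar : (x + d) % 2 = 1)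
    (hok : okT V B N r x (d + 1) 1 (x, d, mask, n, v, mx, pm, nd) = true)
    (hy : y ∈ growT V B N r (advT B r x (d + 1) 1 (x, d, mask, n, v, mx, pm, nd)) (WCount.site x (d + 1) :: l)) :
    y ∈ growT V B N (r + 1) (x, d, mask, n, v, mx, pm, nd) l := by
  rw [growT]
  simp only [List.mem_append]
  refine Or.inr ?_
  have hne : Nat.beq ((x + d) % 2) 0 = false := (natBeq_eq_decide _ _).trans (decide_eq_false (by omega))
  rw [hne, cond_false]
  exact mem_childT.2 ⟨hok, hy⟩

/-- Every output list extends the given reversed prefix by exactly `r` new sites in front. [cite: MadrasSlade1993, Section 4.2, Definition 4.2.1] -/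
theorem exists_append_of_mem_growT : ∀ (r : ℕ) (s : St) (l y : List (ℤ × ℤ)), y ∈ growT V B N r s l → ∃ m, y = m ++ l ∧ m.length = r
  | 0, (x, d, mask, n, v, mx, pm, nd), l, y, hy => ⟨[], by rw [(mem_growT_zero.1 hy).2, List.nil_append], rfl⟩
  | r + 1, (x, d, mask, n, v, mx, pm, nd), l, y, hy => by
    obtain ⟨x', d', dn, -, -, hy'⟩ := mem_growT_succ hy
    obtain ⟨m, hm, hlen⟩ := exists_append_of_mem_growT r _ _ y hy'
    exact ⟨m ++ [WCount.site x' d'], by rw [hm, List.append_assoc, List.singleton_append], by simp [hlen]⟩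

/-- Output lists through different first moves are different. [cite: MadrasSlade1993, Section 4.2, Definition 4.2.1] -/
theorem ne_of_mem_childT {r x₁ d₁ dn₁ x₂ d₂ dn₂ : ℕ} {s : St} {l : List (ℤ × ℤ)} (hne : (x₁, d₁) ≠ (x₂, d₂)) :
    ∀ a ∈ (childT V B N r x₁ d₁ dn₁ s l fun s' l' => growT V B N r s' l'),
      ∀ b ∈ (childT V B N r x₂ d₂ dn₂ s l fun s' l' => growT V B N r s' l'), a ≠ b := by
  intro a h₁ b h₂ hab
  subst hab
  obtain ⟨-, h₁⟩ := mem_childT.1 h₁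
  obtain ⟨-, h₂⟩ := mem_childT.1 h₂
  obtain ⟨m₁, e₁, hl₁⟩ := exists_append_of_mem_growT r _ _ a h₁
  obtain ⟨m₂, e₂, hl₂⟩ := exists_append_of_mem_growT r _ _ a h₂
  rw [e₁] at e₂
  have h := (List.append_inj e₂ (by rw [hl₁, hl₂])).2
  obtain ⟨ex, ed⟩ := WCount.site_inj (List.cons.inj h).1
  exact hne (by rw [ex, ed])

/-- A child list is duplicate-free if the searches one level down are. [cite: MadrasSlade1993, Section 4.2, Definition 4.2.1] -/
theorem nodup_childT {r x' d' dn : ℕ} {s : St} {l : List (ℤ × ℤ)} (ih : ∀ (s' : St) (l' : List (ℤ × ℤ)), (growT V B N r s' l').Nodup) :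
    (childT V B N r x' d' dn s l fun s' l' => growT V B N r s' l').Nodup := by
  unfold childT
  cases okT V B N r x' d' dn s
  · exact List.nodup_nil
  · exact ih _ _

/-- ★ **The pruned search lists are duplicate-free.** [cite: MadrasSlade1993, Section 4.2, Definition 4.2.1] -/
theorem nodup_growT : ∀ (r : ℕ) (s : St) (l : List (ℤ × ℤ)), (growT V B N r s l).Nodup
  | 0, (x, d, mask, n, v, mx, pm, nd), l => by
    show (bif Nat.beq v V && Nat.beq mx x && Nat.beq pm 0 then [l] else []).Nodup
    cases (Nat.beq v V && Nat.beq mx x && Nat.beq pm 0)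
    · exact List.nodup_nil
    · exact List.nodup_singleton l
  | r + 1, (x, d, mask, n, v, mx, pm, nd), l => by
    have ih : ∀ (s' : St) (l' : List (ℤ × ℤ)), (growT V B N r s' l').Nodup := fun s' l' => nodup_growT r s' l'
    have h12 : (x + 1, d) ≠ (x - 1, d) := fun h => by have := (Prod.mk.inj h).1; omega
    have h13 : (x + 1, d) ≠ (x, d - 1) := fun h => by have := (Prod.mk.inj h).1; omega
    have h23 : 1 ≤ d → (x - 1, d) ≠ (x, d - 1) := fun hd h => by have := (Prod.mk.inj h).2; omega
    have h14 : (x + 1, d) ≠ (x, d + 1) := fun h => by have := (Prod.mk.inj h).1; omega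
    have h24 : (x - 1, d) ≠ (x, d + 1) := fun h => by have := (Prod.mk.inj h).2; omega
    rw [growT]
    cases hpar : Nat.beq ((x + d) % 2) 0
    · simp only [cond_false]
      refine List.nodup_append.2 ⟨List.nodup_append.2 ⟨nodup_childT ih, nodup_childT ih, ne_of_mem_childT h12⟩, nodup_childT ih,
        fun a ha b hb => ?_⟩
      rcases List.mem_append.1 ha with ha | ha
      · exact ne_of_mem_childT h14 a ha b hb
      · exact ne_of_mem_childT h24 a ha b hb
    · simp only [cond_true]
      cases hd : Nat.ble 1 d
      · simp only [cond_false, List.append_nil]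
        exact List.nodup_append.2 ⟨nodup_childT ih, nodup_childT ih, ne_of_mem_childT h12⟩
      · simp only [cond_true]
        have h1 : 1 ≤ d := Nat.le_of_ble_eq_true hd
        refine List.nodup_append.2 ⟨List.nodup_append.2 ⟨nodup_childT ih, nodup_childT ih, ne_of_mem_childT h12⟩, nodup_childT ih,
          fun a ha b hb => ?_⟩
        rcases List.mem_append.1 ha with ha | ha
        · exact ne_of_mem_childT h13 a ha b hb
        · exact ne_of_mem_childT (h23 h1) a ha b hb

/-! ### §4  The pruned search explores a SUBSET of the engine's search (so its outputs are sound and injective) -/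

/-- The scalar abstraction of the engine's pending list: its head — the least pending record —, `0` when nothing is pending.
[cite: MadrasSlade1993, Section 4.2, Definition 4.2.1] -/
def pmOf (pend : List ℕ) : ℕ := pend.headD 0

/-- Shape of the engine's pending lists: nondecreasing, positive entries. [cite: MadrasSlade1993, Section 4.2, Definition 4.2.1] -/
def PendOK (pend : List ℕ) : Prop := pend.Pairwise (· ≤ ·) ∧ ∀ p ∈ pend, 1 ≤ p

/-- `PendOK []`. [cite: MadrasSlade1993, Section 4.2, Definition 4.2.1] -/
theorem pendOK_nil : PendOK [] := ⟨List.Pairwise.nil, fun p hp => by simp at hp⟩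

/-- `pmOf pend = 0` iff nothing is pending. [cite: MadrasSlade1993, Section 4.2, Definition 4.2.1] -/
theorem pmOf_eq_zero_iff {pend : List ℕ} (h : PendOK pend) : pmOf pend = 0 ↔ pend = [] := by
  cases pend with
  | nil => simp [pmOf]
  | cons p t =>
    simp only [pmOf, List.headD_cons, reduceCtorEq, iff_false]
    have := h.2 p (by simp)
    omega

/-- The engine's pending-list update, abstracted: discharge the records `≥ x'`, then register `x'` if it is an interior record visit.
[cite: MadrasSlade1993, Section 4.2, Definition 4.2.1] -/
def pendNext (r x' d' n mx : ℕ) (pend : List ℕ) : List ℕ :=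
  if (n + 1) % 2 = 0 ∧ d' = 0 ∧ mx ≤ x' ∧ r ≠ 0 then pend.filter (fun p => Nat.blt p x') ++ [x'] else pend.filter (fun p => Nat.blt p x')

/-- `PendOK` survives the update (for a positive new abscissa). [cite: MadrasSlade1993, Section 4.2, Definition 4.2.1] -/
theorem pendOK_next {pend : List ℕ} (h : PendOK pend) {r x' d' n mx : ℕ} (hx : 1 ≤ x') : PendOK (pendNext r x' d' n mx pend) := by
  have hf : PendOK (pend.filter (fun p => Nat.blt p x')) :=
    ⟨h.1.filter _, fun p hp => h.2 p (List.mem_filter.1 hp).1⟩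
  unfold pendNext
  split_ifs
  · refine ⟨List.pairwise_append.2 ⟨hf.1, List.pairwise_singleton _ _, fun p hp q hq => ?_⟩, fun p hp => ?_⟩
    · rw [List.mem_singleton] at hq
      subst hq
      exact (WCount.mem_filter_blt.1 hp).2.le
    · rcases List.mem_append.1 hp with hp | hp
      · exact hf.2 p hp
      · rw [List.mem_singleton] at hp; omega
  · exact hf

/-- ★ **The least pending record is tracked exactly**: `pmOf (pendNext …) = pmNext … (pmOf pend)`. [cite: MadrasSlade1993, Section 4.2, Definition 4.2.1] -/
theorem pmOf_pendNext {pend : List ℕ} (h : PendOK pend) (r x' d' n mx : ℕ) :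
    pmOf (pendNext r x' d' n mx pend) = pmNext r x' d' n mx (pmOf pend) := by
  rw [pmNext_eq]
  cases pend with
  | nil =>
    simp only [pendNext, pmOf, List.filter_nil, List.nil_append, List.headD_nil, or_true, if_true]
    split_ifs <;> rfl
  | cons p t =>
    have hp1 : 1 ≤ p := h.2 p (by simp)
    have ht : ∀ q ∈ t, p ≤ q := fun q hq => List.rel_of_pairwise_cons h.1 hq
    simp only [pmOf, List.headD_cons]
    by_cases hlt : p < x'
    · -- the head survives
      have hf : (p :: t).filter (fun q => Nat.blt q x') = p :: t.filter (fun q => Nat.blt q x') := by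
        rw [List.filter_cons_of_pos (by rw [Nat.blt_eq]; exact hlt)]
      rw [if_neg (by omega)]
      unfold pendNext
      split_ifs <;> simp [hf]
    · -- everything is discharged
      have hf : (p :: t).filter (fun q => Nat.blt q x') = [] := by
        rw [List.filter_eq_nil_iff]
        intro q hq
        rw [Nat.blt_eq]
        rcases List.mem_cons.1 hq with rfl | hq
        · exact hlt
        · exact fun h' => hlt (lt_of_le_of_lt (ht q hq) h')
      rw [if_pos (Or.inl (by omega))]
      unfold pendNext
      split_ifs <;> simp [hf]

/-- From the scalar test to the engine's test. [cite: MadrasSlade1993, Section 4.2, Definition 4.2.1] -/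
theorem ok_of_okF {r x' d' dn x d mask n v mx nd : ℕ} {pend : List ℕ} {pm : ℕ}
    (h : okF V B N r x' d' dn mask n v mx pm nd = true) : WCount.ok V B r x' d' (x, d, mask, n, v, mx, pend) = true := by
  obtain ⟨h1, h2, -, -, -, -, -, -, -, h9, h10, h11⟩ := okF_iff.1 h
  rw [vNext_eq] at h2 h9
  exact WCount.ok_iff.2 ⟨h11, h10, h1, h9, h2⟩

/-- The scalar move is the engine's move read through `pmOf`. [cite: MadrasSlade1993, Section 4.2, Definition 4.2.1] -/
theorem advT_eq {r x' d' dn x d mask n v mx nd : ℕ} {pend : List ℕ} (hP : PendOK pend) :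
    advT B r x' d' dn (x, d, mask, n, v, mx, pmOf pend, nd) =
      (x', d', mask ||| 2 ^ WCount.key B x' d', n + 1, v + (if (n + 1) % 2 = 0 ∧ d' = 0 then 1 else 0), max mx x',
        pmOf (pendNext r x' d' n mx pend), nd + dn) := by
  simp only [advT, vNext_eq, mxNext_eq, pmOf_pendNext hP, Nat.add_eq]
  rfl

/-- The engine's move, with the pending list named. [cite: MadrasSlade1993, Section 4.2, Definition 4.2.1] -/
theorem advance_eq' {r x' d' x d mask n v mx : ℕ} {pend : List ℕ} :
    WCount.advance B r x' d' (x, d, mask, n, v, mx, pend) =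
      (x', d', mask ||| 2 ^ WCount.key B x' d', n + 1, v + (if (n + 1) % 2 = 0 ∧ d' = 0 then 1 else 0), max mx x',
        pendNext r x' d' n mx pend) := by
  rw [WCount.advance_eq]
  rfl

/-- ★★ **The pruned search is a sub-search of the engine's**: every output list of `growT` from the abstracted state is an output list of
`WCount.grow` from the engine's state. [cite: MadrasSlade1993, Section 4.2, Definition 4.2.1] -/
theorem mem_grow_of_mem_growT : ∀ (r x d mask n v mx nd : ℕ) (pend : List ℕ) (l y : List (ℤ × ℤ)), PendOK pend →
    y ∈ growT V B N r (x, d, mask, n, v, mx, pmOf pend, nd) l → y ∈ WCount.grow V B r (x, d, mask, n, v, mx, pend) l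
  | 0, x, d, mask, n, v, mx, nd, pend, l, y, hP, hy => by
    obtain ⟨hfin, rfl⟩ := mem_growT_zero.1 hy
    simp only [Bool.and_eq_true, Nat.beq_eq] at hfin
    obtain ⟨⟨hv, hmx⟩, hpm⟩ := hfin
    exact WCount.mem_grow_zero.2 ⟨WCount.final_iff.2 ⟨hv, hmx, (pmOf_eq_zero_iff hP).1 hpm⟩, rfl⟩
  | r + 1, x, d, mask, n, v, mx, nd, pend, l, y, hP, hy => by
    obtain ⟨x', d', dn, hcand, hok, hy'⟩ := mem_growT_succ hy
    have hokF : okF V B N r x' d' dn mask n v mx (pmOf pend) nd = true := hok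
    have hok' : WCount.ok V B r x' d' (x, d, mask, n, v, mx, pend) = true := ok_of_okF hokF
    have hx1 : 1 ≤ x' := (okF_iff.1 hokF).2.2.2.2.2.2.2.2.2.2.2
    rw [advT_eq hP] at hy'
    have ih : y ∈ WCount.grow V B r (WCount.advance B r x' d' (x, d, mask, n, v, mx, pend)) (WCount.site x' d' :: l) := by
      rw [advance_eq']
      exact mem_grow_of_mem_growT r x' d' (mask ||| 2 ^ WCount.key B x' d') (n + 1)
        (v + (if (n + 1) % 2 = 0 ∧ d' = 0 then 1 else 0)) (max mx x') (nd + dn) (pendNext r x' d' n mx pend)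
        (WCount.site x' d' :: l) y (pendOK_next hP hx1) hy'
    rcases hcand with ⟨rfl, rfl, -⟩ | ⟨rfl, rfl, -⟩ | ⟨rfl, hdd, hpar, -⟩ | ⟨rfl, rfl, hpar, -⟩
    · exact WCount.mem_grow_succ_of_right hok' ih
    · exact WCount.mem_grow_succ_of_left hok' ih
    · obtain rfl : d' = d - 1 := by omega
      exact WCount.mem_grow_succ_of_up hpar (by omega) hok' ih
    · exact WCount.mem_grow_succ_of_down hpar hok' ih

/-- ★★ **Every list of the pruned census is a list of the engine's census.** [cite: MadrasSlade1993, Section 4.2, Definition 4.2.1, (4.2.2)] -/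
theorem mem_census_of_mem_censusT {y : List (ℤ × ℤ)} (hy : y ∈ censusT N V) : y ∈ WCount.census N V := by
  have h := mem_grow_of_mem_growT (V := V) (B := N + 1) (N := N) N 0 0 1 0 0 0 0 [] [((0 : ℤ), (0 : ℤ))] y pendOK_nil
  have e : WCount.init (N + 1) = (0, 0, 1, 0, 0, 0, []) := by simp [WCount.init, WCount.key]
  rw [WCount.census, e]
  exact h hy

/-! ### §5  Completeness: an irreducible positive wall bridge passes every look-ahead cut -/

section completeness

variable {ω : ℕ → Site 2}

/-- Manhattan bound along a brick-wall walk: the displacement over `i` steps has `ℓ¹`-norm at most `i`.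
[cite: EntingJensen2009, Section 7.4.2, Fig. 7.10] -/
theorem abs_add_abs_le (hbw : IsBW N ω) (t : ℕ) : ∀ i, t + i ≤ N → |ω (t + i) 0 - ω t 0| + |ω (t + i) 1 - ω t 1| ≤ i
  | 0, _ => by simp
  | i + 1, hi => by
    have h1 := abs_add_abs_le hbw t i (by omega)
    have h2 := (brickWallGraph_adj_coord _ _).1 (hbw (t + i) (by omega))
    rw [show t + (i + 1) = t + i + 1 by omega]
    simp only [abs_eq_max_neg] at h1 ⊢
    push_cast
    rcases h2 with ⟨h | h, hv⟩ | ⟨h0, ⟨h, -⟩ | ⟨h, -⟩⟩ <;> omega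

/-- Three-point Manhattan bound: passing through an intermediate time costs the two horizontal legs plus the net vertical displacement.
[cite: EntingJensen2009, Section 7.4.2, Fig. 7.10] -/
theorem abs_three_le (hbw : IsBW N ω) {t₁ t₂ : ℕ} (h12 : t₁ ≤ t₂) :
    ∀ i, t₂ + i ≤ N → |ω t₂ 0 - ω t₁ 0| + |ω (t₂ + i) 0 - ω t₂ 0| + |ω (t₂ + i) 1 - ω t₁ 1| ≤ (t₂ - t₁ : ℕ) + i
  | 0, h0 => by
    have h1 := abs_add_abs_le hbw t₁ (t₂ - t₁) (by omega)
    rw [show t₁ + (t₂ - t₁) = t₂ by omega] at h1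
    simp only [sub_self, abs_zero, add_zero, Nat.cast_zero]
    exact h1
  | i + 1, hi => by
    have h1 := abs_three_le hbw h12 i (by omega)
    have h2 := (brickWallGraph_adj_coord _ _).1 (hbw (t₂ + i) (by omega))
    rw [show t₂ + (i + 1) = t₂ + i + 1 by omega]
    simp only [abs_eq_max_neg] at h1 ⊢
    push_cast at h1 ⊢
    rcases h2 with ⟨h | h, hv⟩ | ⟨h0, ⟨h, -⟩ | ⟨h, -⟩⟩ <;> omega

/-- Down-step indicator of the step at time `n`. [cite: MadrasSlade1993, Section 1.2] -/
noncomputable def dnOf (ω : ℕ → Site 2) (n : ℕ) : ℕ := if ω (n + 1) 0 = ω n 0 ∧ ω (n + 1) 1 = ω n 1 - 1 then 1 else 0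

/-- One more step: the down-step count grows by the indicator. [cite: MadrasSlade1993, Section 1.2] -/
theorem card_stepsD_succ (ω : ℕ → Site 2) (n : ℕ) : #(stepsD (n + 1) ω) = #(stepsD n ω) + dnOf ω n := by
  unfold stepsD dnOf
  rw [Finset.range_add_one, Finset.filter_insert]
  split_ifs with h
  · rw [Finset.card_insert_of_notMem (by simp)]
  · rfl

/-- The down-step count is monotone in time. [cite: MadrasSlade1993, Section 1.2] -/
theorem card_stepsD_mono (ω : ℕ → Site 2) {m n : ℕ} (h : m ≤ n) : #(stepsD m ω) ≤ #(stepsD n ω) :=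
  Finset.card_le_card (Finset.filter_subset_filter _ (Finset.range_mono h))

/-- The scalar state read off the engine's state and a down-step count. [cite: MadrasSlade1993, Section 4.2, Definition 4.2.1] -/
def toT (s : WCount.St) (nd : ℕ) : St :=
  match s with
  | (x, d, mask, nn, v, mx, pend) => (x, d, mask, nn, v, mx, pmOf pend, nd)

/-- The trajectory of scalar states of a walk through the pruned search. [cite: MadrasSlade1993, Section 4.2, Definition 4.2.1] -/
noncomputable def trajT (N : ℕ) (ω : ℕ → Site 2) (n : ℕ) : St := toT (WCount.traj N ω n) (#(stepsD n ω))

/-- The engine's pending lists along a genuine walk are nondecreasing with positive entries. [cite: MadrasSlade1993, Section 4.2, Definition 4.2.1] -/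
theorem pendOK_traj (hω : ω ∈ ipwb N) : ∀ n, n ≤ N → ∀ {x d mask nn v mx : ℕ} {pend : List ℕ},
    WCount.traj N ω n = (x, d, mask, nn, v, mx, pend) → PendOK pend
  | 0, _, x, d, mask, nn, v, mx, pend, he => by
    simp only [WCount.traj, WCount.init, Prod.mk.injEq] at he
    obtain ⟨-, -, -, -, -, -, rfl⟩ := he
    exact pendOK_nil
  | n + 1, hn, x, d, mask, nn, v, mx, pend, he => by
    rcases he0 : WCount.traj N ω n with ⟨x₀, d₀, mask₀, nn₀, v₀, mx₀, pend₀⟩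
    have h0 := pendOK_traj hω n (by omega) he0
    rw [WCount.traj, he0, advance_eq', Prod.mk.injEq] at he
    simp only [Prod.mk.injEq] at he
    obtain ⟨-, -, -, -, -, -, rfl⟩ := he
    have hx1 : 1 ≤ WCount.xOf ω (n + 1) := by
      obtain ⟨h00, -, -, -, -, -, hbr, -⟩ := WCount.facts_of_mem_ipwb hω
      have h := (hbr (n + 1) (Nat.succ_pos n) hn).1
      have e := WCount.cast_xOf hω hn
      simp only [h00, Pi.zero_apply] at h
      omega
    exact pendOK_next h0 hx1

/-- The scalar trajectory, explicitly. [cite: MadrasSlade1993, Section 4.2, Definition 4.2.1] -/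
theorem trajT_eq {n x d mask nn v mx : ℕ} {pend : List ℕ} (he : WCount.traj N ω n = (x, d, mask, nn, v, mx, pend)) :
    trajT N ω n = (x, d, mask, nn, v, mx, pmOf pend, #(stepsD n ω)) := by
  rw [trajT, he]
  rfl

/-- ★ One step of the scalar trajectory is the pruned search's move. [cite: MadrasSlade1993, Section 4.2, Definition 4.2.1] -/
theorem trajT_succ (hω : ω ∈ ipwb N) {n : ℕ} (hn : n + 1 ≤ N) :
    trajT N ω (n + 1) = advT (N + 1) (N - (n + 1)) (WCount.xOf ω (n + 1)) (WCount.dOf ω (n + 1)) (dnOf ω n) (trajT N ω n) := by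
  rcases he : WCount.traj N ω n with ⟨x, d, mask, nn, v, mx, pend⟩
  have hP := pendOK_traj hω n (by omega) he
  have he1 : WCount.traj N ω (n + 1) = (WCount.xOf ω (n + 1), WCount.dOf ω (n + 1), mask ||| 2 ^ WCount.key (N + 1) (WCount.xOf ω (n + 1)) (WCount.dOf ω (n + 1)),
      nn + 1, v + (if (nn + 1) % 2 = 0 ∧ WCount.dOf ω (n + 1) = 0 then 1 else 0), max mx (WCount.xOf ω (n + 1)),
      pendNext (N - (n + 1)) (WCount.xOf ω (n + 1)) (WCount.dOf ω (n + 1)) nn mx pend) := by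
    rw [WCount.traj, he, advance_eq']
  rw [trajT_eq he1, trajT_eq he, advT_eq hP, card_stepsD_succ]

/-- ★★ **A genuine irreducible positive wall bridge passes the scalar test at every step**: the engine's five conditions (`WCount.ok_traj`) and
the six look-ahead cuts — bridge and end look-ahead by the Manhattan bound to the final site `(X_N, 0)` (`X_N ≥` running maximum, `X_N ≥ 2v + 2`
by the six-step law), irreducibility look-ahead through the forced later return to the column of the least pending record visit (three-point
Manhattan bound), and the six-step-law budgets `X_N + 4v ≤ N + 2`, `#down + 6v ≤ N + 2`, `X_N + #down + 4v ≤ N + 4`.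
[cite: MadrasSlade1993, Section 1.2, Definition 1.2.4; Section 4.2, Definition 4.2.1, remark before (4.2.21) (p. 94)] [cite: Kesten1963SAW, Section 4] -/
theorem okF_traj (hω : ω ∈ ipwb N) (hv : visits N ω = V) (h4 : 4 ≤ N) {n : ℕ} (hn : n + 1 ≤ N) {x d mask nn v mx : ℕ} {pend : List ℕ}
    (he : WCount.traj N ω n = (x, d, mask, nn, v, mx, pend)) :
    okF V (N + 1) N (N - (n + 1)) (WCount.xOf ω (n + 1)) (WCount.dOf ω (n + 1)) (dnOf ω n) mask nn v mx (pmOf pend) (#(stepsD n ω)) = true := by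
  obtain ⟨h0, hbw, hinj, hH, ⟨hN2, hYN⟩, hwb, hbr, hirr⟩ := WCount.facts_of_mem_ipwb hω
  -- the engine's own test
  have hok := WCount.ok_traj hω hv hn he
  obtain ⟨h1x', hd'r, hbit, hbudget, hfeas⟩ := WCount.ok_iff.1 hok
  -- the state at time `n + 1`
  have hP := pendOK_traj hω n (by omega) he
  have hI0 := WCount.invC_traj hω n (by omega)
  rw [he] at hI0
  obtain ⟨-, -, htime, -, -, -, -, -⟩ := hI0
  simp only at htime
  have hI1 := WCount.invC_traj hω (n + 1) hn
  rw [WCount.traj, he, advance_eq'] at hI1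
  obtain ⟨-, -, -, -, -, hmxle, hmxat, hpend⟩ := hI1
  simp only at hmxle hmxat hpend
  have hX' := WCount.cast_xOf hω hn
  have hY' := WCount.cast_dOf hω hn
  set x' := WCount.xOf ω (n + 1) with hx'
  set d' := WCount.dOf ω (n + 1) with hd'
  set r := N - (n + 1) with hr
  -- `X_N ≥` the new running maximum, `X_N ≥ 2V + 2`, the six-step budgets
  have hM : ((max mx x' : ℕ) : ℤ) ≤ ω N 0 := by
    obtain ⟨i, hi, hei⟩ := hmxat
    rw [hei]
    exact (hwb i (hi.trans hn)).2
  have hG := two_mul_visits_add_two_le_apply hω h4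
  have hD := apply_add_four_mul_visits_le hω h4
  have hC := card_stepsD_add_six_mul_visits_le hω h4
  have hE := apply_add_card_stepsD_add_four_mul_visits_le hω h4
  have hZ := two_mul_card_stepsD_add_six_mul_visits_le hω h4
  rw [hv] at hG hD hC hE hZ
  have hnd : #(stepsD n ω) + dnOf ω n ≤ #(stepsD N ω) := by
    rw [← card_stepsD_succ]; exact card_stepsD_mono ω hn
  -- Manhattan to the end
  have hM2 := abs_add_abs_le hbw (n + 1) r (by omega)
  rw [show n + 1 + r = N by omega, hYN] at hM2
  simp only [abs_eq_max_neg] at hM2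
  -- the irreducibility look-ahead
  have hB : pmNext r x' d' nn mx (pmOf pend) = 0 ∨
      (x' - pmNext r x' d' nn mx (pmOf pend)) + (mxNext mx x' - pmNext r x' d' nn mx (pmOf pend)) + d' ≤ r := by
    rw [← pmOf_pendNext hP, mxNext_eq]
    rcases hq : pendNext r x' d' nn mx pend with _ | ⟨p, t⟩
    · exact Or.inl rfl
    · right
      simp only [pmOf, List.headD_cons]
      obtain ⟨k, hk1, hkn, hkN, hk2, hYk, hpk, hrec, hlive⟩ := hpend p (by rw [hq]; simp)
      -- `k` is not a wall-renewal time: a later abscissa is `≤ X_k`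
      have hj : ∃ j, k < j ∧ j ≤ N ∧ ω j 0 ≤ ω k 0 := by
        by_contra hcon
        push Not at hcon
        refine hirr k hk1 hkN ⟨⟨by omega, fun i hi1 hi => ⟨?_, hrec i hi⟩, fun i hi1 hi => ⟨?_, ?_⟩⟩, hk2, hYk⟩
        · exact (hbr i hi1 (by omega)).1
        · simpa using hcon (k + i) (by omega) (by omega)
        · simpa [show k + (N - k) = N by omega] using (hwb (k + i) (by omega)).2
      obtain ⟨j, hkj, hjN, hXj⟩ := hj
      have hjn : n + 1 < j := by
        by_contra hle
        exact absurd (hlive j hkj (by omega)) (not_lt.2 hXj)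
      have hM3 := abs_three_le hbw (show n + 1 ≤ j by omega) (N - j) (by omega)
      rw [show j + (N - j) = N by omega, hYN] at hM3
      simp only [abs_eq_max_neg] at hM3
      omega
  refine okF_iff.2 ⟨hbit, ?_, ?_, ?_, hB, ?_, ?_, ?_, ?_, ?_, hd'r, h1x'⟩
  · rw [vNext_eq]; exact hfeas
  · rw [mxNext_eq]; omega
  · omega
  · rw [mxNext_eq]; omega
  · omega
  · omega
  · rw [mxNext_eq]; omega
  · rw [vNext_eq]; exact hbudget

/-- ★ **Completeness of the pruned search**: the full reversed list lies in the completion of each of its prefixes.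
[cite: MadrasSlade1993, Section 4.2, Definition 4.2.1] -/
theorem revList_mem_growT (hω : ω ∈ ipwb N) (hv : visits N ω = V) (h4 : 4 ≤ N) :
    ∀ r, r ≤ N → revList ω N ∈ growT V (N + 1) N r (trajT N ω (N - r)) (revList ω (N - r))
  | 0, _ => by
    rw [Nat.sub_zero]
    rcases he : WCount.traj N ω N with ⟨x, d, mask, nn, v, mx, pend⟩
    have hfin := WCount.final_traj hω hv
    rw [he] at hfin
    obtain ⟨hvV, hmx, hpe⟩ := WCount.final_iff.1 hfin
    rw [trajT_eq he]
    refine mem_growT_zero.2 ⟨?_, rfl⟩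
    simp [hvV, hmx, hpe, pmOf]
  | r + 1, hr => by
    obtain ⟨h0, hbw, hinj, hH, ⟨hN2, hYN⟩, hwb, hbr, hirr⟩ := WCount.facts_of_mem_ipwb hω
    set n := N - (r + 1) with hn
    have hn1 : n + 1 ≤ N := by omega
    have ih := revList_mem_growT hω hv h4 r (Nat.le_of_succ_le hr)
    rw [show N - r = n + 1 by omega, trajT_succ hω hn1, show N - (n + 1) = r by omega, revList, ← WCount.site_xOf_dOf hω hn1] at ih
    rcases he : WCount.traj N ω n with ⟨x, d, mask, nn, v, mx, pend⟩
    rw [trajT_eq he] at ih ⊢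
    have hok := okF_traj hω hv h4 hn1 he
    rw [show N - (n + 1) = r by omega] at hok
    have hI := WCount.invC_traj hω n (by omega)
    rw [he] at hI
    obtain ⟨hx, hd, -, -, -, -, -, -⟩ := hI
    simp only at hx hd
    have hX := WCount.cast_xOf hω (Nat.le_of_succ_le hn1)
    have hY := WCount.cast_dOf hω (Nat.le_of_succ_le hn1)
    have hX' := WCount.cast_xOf hω hn1
    have hY' := WCount.cast_dOf hω hn1
    rw [← hx] at hX
    rw [← hd] at hY
    have hadj := (brickWallGraph_adj_coord _ _).1 (hbw n (by omega))
    have hpos' := (hbr (n + 1) (Nat.succ_pos n) hn1).1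
    simp only [h0, Pi.zero_apply] at hpos'
    rcases hadj with ⟨hh | hh, hv1⟩ | ⟨hv0, ⟨hu, hpar⟩ | ⟨hdn, hpar⟩⟩
    · -- right
      have edn : dnOf ω n = 0 := by unfold dnOf; rw [if_neg (by omega)]
      obtain ⟨e1, e2⟩ : WCount.xOf ω (n + 1) = x + 1 ∧ WCount.dOf ω (n + 1) = d := ⟨by omega, by omega⟩
      rw [e1, e2, edn] at hok ih
      exact mem_growT_succ_of_right hok ih
    · -- left
      have edn : dnOf ω n = 0 := by unfold dnOf; rw [if_neg (by omega)]
      obtain ⟨e1, e2⟩ : WCount.xOf ω (n + 1) = x - 1 ∧ WCount.dOf ω (n + 1) = d := ⟨by omega, by omega⟩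
      rw [e1, e2, edn] at hok ih
      exact mem_growT_succ_of_left hok ih
    · -- up
      have edn : dnOf ω n = 0 := by unfold dnOf; rw [if_neg (by omega)]
      obtain ⟨e1, e2⟩ : WCount.xOf ω (n + 1) = x ∧ WCount.dOf ω (n + 1) = d - 1 := ⟨by omega, by omega⟩
      rw [e1, e2, edn] at hok ih
      exact mem_growT_succ_of_up (by omega) (by omega) hok ih
    · -- down
      have edn : dnOf ω n = 1 := by unfold dnOf; rw [if_pos ⟨by omega, by omega⟩]
      obtain ⟨e1, e2⟩ : WCount.xOf ω (n + 1) = x ∧ WCount.dOf ω (n + 1) = d + 1 := ⟨by omega, by omega⟩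
      rw [e1, e2, edn] at hok ih
      exact mem_growT_succ_of_down (by omega) hok ih

/-- ★★ **Completeness**: the reversed site list of an irreducible positive wall bridge of length `N ≥ 4` with `V` visits is in the pruned census.
[cite: MadrasSlade1993, Section 4.2, Definition 4.2.1, (4.2.2)] [cite: Kesten1963SAW, Section 4] -/
theorem revList_mem_censusT (hω : ω ∈ ipwb N) (hv : visits N ω = V) (h4 : 4 ≤ N) : revList ω N ∈ censusT N V := by
  have h := revList_mem_growT hω hv h4 N le_rfl
  obtain ⟨h0, -⟩ := WCount.facts_of_mem_ipwb hω
  have e : revList ω (N - N) = [(0, 0)] := by rw [Nat.sub_self, revList]; simp [h0, ofSite]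
  have e2 : trajT N ω (N - N) = (0, 0, 1, 0, 0, 0, 0, 0) := by
    rw [Nat.sub_self, trajT_eq (show WCount.traj N ω 0 = WCount.init (N + 1) from rfl)]
    simp [WCount.key, pmOf, stepsD]
  rwa [e, e2] at h

end completeness

/-! ### §6  The fast count is exact -/

open Classical in
/-- ★★★ **THE FAST COUNTING THEOREM**: for every even length `N ≥ 4` and every `V`, the number of irreducible positive wall bridges of length `N`
with `V` surface visits is the scalar count `fcount N V` — one closed `Nat` term on kernel-accelerated arithmetic, pruned by the look-ahead cuts.
[cite: MadrasSlade1993, Section 4.2, Definition 4.2.1, (4.2.2)] [cite: Kesten1963SAW, Section 4] [cite: EntingJensen2009, Section 7.4.2, Fig. 7.10] -/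
theorem card_filter_visits_ipwb_eq_fcount (hN : N % 2 = 0) (h4 : 4 ≤ N) :
    #((ipwb N).filter fun ω => visits N ω = V) = fcount N V := by
  rw [← length_censusT]
  refine le_antisymm ?_ ?_
  · refine le_trans (Finset.card_le_card_of_injOn (fun ω => revList ω N) (fun ω hω => ?_) fun ω hω ω' hω' h => ?_)
      (List.toFinset_card_le _)
    · obtain ⟨hω, hv⟩ := Finset.mem_filter.1 (Finset.mem_coe.1 hω)
      exact Finset.mem_coe.2 (List.mem_toFinset.2 (revList_mem_censusT hω hv h4))
    · have hω := (Finset.mem_filter.1 (Finset.mem_coe.1 hω)).1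
      have hω' := (Finset.mem_filter.1 (Finset.mem_coe.1 hω')).1
      exact WCensus.eq_of_revList_eq (WCensus.frozen_of_mem_ipwb hω) (WCensus.frozen_of_mem_ipwb hω') h
  · have hnd : (censusT N V).Nodup := nodup_growT _ _ _
    rw [← List.toFinset_card_of_nodup hnd, WCount.card_filter_visits_ipwb_eq_census hN (by omega)]
    exact Finset.card_le_card fun y hy => List.mem_toFinset.2 (mem_census_of_mem_censusT (List.mem_toFinset.1 hy))

/-- ★ **Agreement with the engine**: `fcount N V = #(WCount.census N V)` for even `N ≥ 4`. [cite: MadrasSlade1993, Section 4.2, (4.2.2)] -/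
theorem fcount_eq_length_census (hN : N % 2 = 0) (h4 : 4 ≤ N) : fcount N V = (WCount.census N V).length := by
  classical
  rw [← card_filter_visits_ipwb_eq_fcount hN h4, WCount.card_filter_visits_ipwb_eq_length_census hN (by omega)]

/-! ### §7  Splitting the fast count over the depth-`k` prefixes (one kernel evaluation per piece) -/

/-- The scalar count on a tuple state. [cite: MadrasSlade1993, Section 4.2, Definition 4.2.1] -/
def cntS (V B N r : ℕ) (s : St) : ℕ :=
  match s with
  | (x, d, mask, n, v, mx, pm, nd) => cnt V B N r x d mask n v mx pm nd

/-- The admissible children of a tuple state, in the search order (right, left, vertical). [cite: MadrasSlade1993, Section 4.2, Definition 4.2.1] -/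
def kidsF (V B N r : ℕ) (s : St) : List St :=
  match s with
  | (x, d, _, _, _, _, _, _) =>
    (bif okT V B N r (x + 1) d 0 s then [advT B r (x + 1) d 0 s] else []) ++
    (bif okT V B N r (x - 1) d 0 s then [advT B r (x - 1) d 0 s] else []) ++
    (bif Nat.beq ((x + d) % 2) 0 then
      (bif Nat.ble 1 d then (bif okT V B N r x (d - 1) 0 s then [advT B r x (d - 1) 0 s] else []) else [])
     else (bif okT V B N r x (d + 1) 1 s then [advT B r x (d + 1) 1 s] else []))

/-- One level of the count as a sum over the children. [cite: MadrasSlade1993, Section 4.2, Definition 4.2.1] -/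
theorem cntS_succ (V B N r x d mask n v mx pm nd : ℕ) :
    cntS V B N (r + 1) (x, d, mask, n, v, mx, pm, nd) = ((kidsF V B N r (x, d, mask, n, v, mx, pm, nd)).map (cntS V B N r)).sum := by
  have hc : ∀ x' d' dn : ℕ,
      ((bif okT V B N r x' d' dn (x, d, mask, n, v, mx, pm, nd) then [advT B r x' d' dn (x, d, mask, n, v, mx, pm, nd)] else []).map
        (cntS V B N r)).sum =
      (bif okF V B N r x' d' dn mask n v mx pm nd then
        cnt V B N r x' d' (Nat.lor mask (Nat.pow 2 (Nat.add (Nat.mul x' B) d'))) (n + 1) (vNext n d' v) (mxNext mx x')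
          (pmNext r x' d' n mx pm) (Nat.add nd dn) else 0) := by
    intro x' d' dn
    have e : okT V B N r x' d' dn (x, d, mask, n, v, mx, pm, nd) = okF V B N r x' d' dn mask n v mx pm nd := rfl
    rw [e]
    cases okF V B N r x' d' dn mask n v mx pm nd <;> rfl
  show cnt V B N (r + 1) x d mask n v mx pm nd = _
  rw [cnt, kidsF]
  simp only [List.map_append, List.sum_append, hc, Nat.add_eq]
  cases Nat.beq ((x + d) % 2) 0 <;> cases Nat.ble 1 d <;> simp [hc]

/-- `k` levels of the search from a list of states with `r` steps to go at the top. [cite: MadrasSlade1993, Section 4.2, Definition 4.2.1] -/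
def expandF (V B N : ℕ) : ℕ → ℕ → List St → List St
  | 0, _, ps => ps
  | k + 1, r, ps => expandF V B N k (r - 1) (ps.flatMap fun s => kidsF V B N (r - 1) s)

/-- [folklore] Bookkeeping: a sum over a `flatMap` (private twin of «CENSUS-NINE-B»'s `WCount.sum_map_flatMap_wc`). -/
private theorem sum_map_flatMap_wf {α β : Type} (ps : List α) (g : α → List β) (f : β → ℕ) :
    ((ps.flatMap g).map f).sum = (ps.map fun p => ((g p).map f).sum).sum := by
  induction ps with
  | nil => simp
  | cons a t ih => simp [List.flatMap_cons, List.map_append, List.sum_append, ih]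

/-- ★ **The count below a list of states is the count below their depth-`k` descendants.** [cite: MadrasSlade1993, Section 4.2, Definition 4.2.1] -/
theorem sum_cntS_eq_expand (V B N : ℕ) :
    ∀ (k r : ℕ) (ps : List St), k ≤ r → (ps.map (cntS V B N r)).sum = ((expandF V B N k r ps).map (cntS V B N (r - k))).sum
  | 0, r, ps, _ => by simp [expandF]
  | k + 1, r, ps, hk => by
    obtain ⟨r', rfl⟩ : ∃ r', r = r' + 1 := ⟨r - 1, by omega⟩
    rw [expandF, Nat.add_sub_cancel, show r' + 1 - (k + 1) = r' - k by omega, ← sum_cntS_eq_expand V B N k r' _ (by omega),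
      sum_map_flatMap_wf]
    congr 1
    refine List.map_congr_left fun s _ => ?_
    obtain ⟨x, d, mask, n, v, mx, pm, nd⟩ := s
    exact cntS_succ V B N r' x d mask n v mx pm nd

/-- ★ **Splitting the fast count over the depth-`k` prefixes**: with `n` the number of prefix states,
`fcount N V = Σ_{i < n} cntS (N − k) (state i)` — each summand its own kernel evaluation (`Option.elim` keeps the others unevaluated).
[cite: MadrasSlade1993, Section 4.2, Definition 4.2.1, (4.2.2)] -/
theorem fcount_eq_sum_range (N V k : ℕ) (hk : k ≤ N) {n : ℕ}
    (hn : (expandF V (N + 1) N k N [(0, 0, 1, 0, 0, 0, 0, 0)]).length = n) :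
    fcount N V = ((List.range n).map fun i =>
      ((expandF V (N + 1) N k N [(0, 0, 1, 0, 0, 0, 0, 0)])[i]?).elim 0 (cntS V (N + 1) N (N - k))).sum := by
  have h := sum_cntS_eq_expand V (N + 1) N k N [((0 : ℕ), (0 : ℕ), (1 : ℕ), (0 : ℕ), (0 : ℕ), (0 : ℕ), (0 : ℕ), (0 : ℕ))] hk
  simp only [List.map_cons, List.map_nil, List.sum_cons, List.sum_nil, Nat.add_zero] at h
  rw [show fcount N V = cntS V (N + 1) N N (0, 0, 1, 0, 0, 0, 0, 0) from rfl, h, ← hn]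
  set L := expandF V (N + 1) N k N [((0 : ℕ), (0 : ℕ), (1 : ℕ), (0 : ℕ), (0 : ℕ), (0 : ℕ), (0 : ℕ), (0 : ℕ))]
  clear h hn hk
  induction L with
  | nil => simp
  | cons a t ih =>
    rw [List.map_cons, List.sum_cons, List.length_cons, List.range_succ_eq_map, List.map_cons, List.sum_cons, List.map_map]
    rw [ih]
    rfl

/-- Sanity of the split API: the class `(10,3)` through its depth-`4` prefixes (kernel). [cite: MadrasSlade1993, Section 4.2, (4.2.2)] -/
theorem fcount_twenty_three_split : ((expandF 3 21 20 4 20 [(0, 0, 1, 0, 0, 0, 0, 0)]).map (cntS 3 21 20 16)).sum = 7 := by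
  decide +kernel

end WFast

end Literature.Probability.RandomPlanarGeometry.SAW.HexBW.Wall
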